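import Summits.Ventures.PercRepro.Night2ThreeTwoNonBad

/-!
# PercRepro — the cell `(3, 2)`: a target that receives distance-one load is «a rank-`2` set plus three points»
(night-2, gen 26)

Groundwork for the obstruction cells with `|V| ≤ 10`, continued.  Under the missed-point rule the loads `dload` come
from the big pairs `(B, z)` with a positive loss, whose covering set `B ∪ {z}` is then SATURATED (`capS < L1`); a
saturated set has two thin covering preimages, so it is bad (`Night2ThreeTwoNonBad`), and the missed-point target
`B ∪ {z, x}` is bad plus one point.  Hence at a target that is not even WEAKLY bad the fair-share capacity is the full
`cap3 = cap2 ≥ 11/60`: the income of a basis pair through its non-weakly-bad middle targets needs no dload bound at all.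

* `WBadTarget`: the off-coloop part is a rank-`≤ 2` set plus three points;
* `bad_of_saturated`, `saturated_of_loss_ne_zero`;
* **`wbad_of_dload_ne_zero`**: a target with `dload ≠ 0` (missed-point rule, any `P`) is weakly bad;
* **`cap3_ge_of_not_wbad`**: `cap3 ≥ 11/60` at every target that is not weakly bad.
-/

namespace PercRepro.Shadow

open Finset PerFlat ThmH

variable {α : Type*} [DecidableEq α] {M : Matroid α} [M.Finite]

section WeakBad

variable {G : Finset α}

/-- A target is WEAKLY BAD when its off-coloop part is a rank-`≤ 2` set plus three points. -/
def WBadTarget (M : Matroid α) [M.Finite] (G S : Finset α) : Prop :=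
  ∃ x ∈ S \ coloops M G, BadTarget M G (S.erase x)

open scoped Classical in
/-- A saturated target of the cell is bad. -/
theorem bad_of_saturated (hG : G ∈ flatsQ M (5 + 1)) (hd : (gr M \ G).card = 3) (hk : kColoops M G = 2)
    {S : Finset α} (hS : S ∈ shadowAt M (5 + 2) 5 (Uq M (5 + 2) 5) G) (hsat : capS M 5 G S < L1 M 5 G S) :
    BadTarget M G S := by
  by_contra hnb
  have h1 := L1_le_of_not_bad hG hd hk hS hnb
  have h2 := capS_ge_five_twelfths_three_two hd hk (subset_G_of_mem_shadowAt hS)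
  linarith

open scoped Classical in
/-- A pair with a nonzero loss has a saturated covering set. -/
theorem saturated_of_loss_ne_zero {q : ℕ} {B : Finset α} {z : α} (hl : loss M q G B z ≠ 0) :
    capS M q G (insert z B) < L1 M q G (insert z B) := by
  by_contra h
  push Not at h
  apply hl
  unfold loss fS
  rw [if_pos h]
  ring

open scoped Classical in
/-- **A target with a nonzero distance-one load is weakly bad** (missed-point rule, any predicate `P`): the load
comes from a source `B` with a pair `z` of positive loss, whose covering set `B ∪ {z}` is saturated, hence bad, and the
target is `B ∪ {z, x}`. -/
theorem wbad_of_dload_ne_zero (hG : G ∈ flatsQ M (5 + 1)) (hd : (gr M \ G).card = 3) (hk : kColoops M G = 2)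
    {P : Finset α → Prop} [DecidablePred P] {S : Finset α}
    (hdl : dload M 5 G P (dshMissed M 5 G) S ≠ 0) : WBadTarget M G S := by
  have hd' : (gr M \ G).card ≤ 5 := by omega
  have hle := dload_missed_le_sum_sources (P := P) hG hd' S
  have hpos : 0 < dload M 5 G P (dshMissed M 5 G) S :=
    lt_of_le_of_ne (dload_nonneg (fun B z S => dshMissed_nonneg hG hd' B z S) S) (Ne.symm hdl)
  -- some source has a pair with a nonzero loss
  have hex : ∃ B ∈ missedSources M 5 G P S, ∃ z ∈ S \ B, loss M 5 G B z ≠ 0 := by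
    by_contra hcon
    push Not at hcon
    have hzero : ∑ B ∈ missedSources M 5 G P S, ∑ z ∈ S \ B,
        loss M 5 G B z / (((G \ clF M B).card : ℚ) - 1) = 0 := by
      apply Finset.sum_eq_zero
      intro B hB
      apply Finset.sum_eq_zero
      intro z hz
      rw [hcon B hB z hz, zero_div]
    linarith
  obtain ⟨B, hB, z, hz, hl⟩ := hex
  obtain ⟨⟨hthin, -⟩, hBS, hcard, hmiss⟩ := mem_missedSources.1 hB
  have hzc : z ∈ G \ clF M B := hmiss hz
  have hQ : insert z B ∈ shadowAt M (5 + 2) 5 (Uq M (5 + 2) 5) G := insert_mem_shadowAt_thin hG hthin hzc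
  have hbad : BadTarget M G (insert z B) := bad_of_saturated hG hd hk hQ (saturated_of_loss_ne_zero hl)
  -- the second missed point `x`
  have hzS : z ∈ S \ B := hz
  obtain ⟨x, hxS, hxz⟩ : ∃ x ∈ S \ B, x ≠ z := by
    obtain ⟨a, b, hab, hpair⟩ := Finset.card_eq_two.1 hcard
    by_cases haz : a = z
    · refine ⟨b, by rw [hpair]; simp, ?_⟩
      intro hbz; exact hab (haz.trans hbz.symm)
    · exact ⟨a, by rw [hpair]; simp, haz⟩
  have hxB : x ∉ B := (Finset.mem_sdiff.1 hxS).2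
  have hxQ : x ∉ insert z B := by
    rw [Finset.mem_insert, not_or]; exact ⟨hxz, hxB⟩
  have hSeq : S = insert x (insert z B) := by
    apply Finset.eq_of_subset_of_card_le
    · intro a ha
      rw [Finset.mem_insert, Finset.mem_insert]
      by_cases haB : a ∈ B
      · exact Or.inr (Or.inr haB)
      · have ha' : a ∈ S \ B := Finset.mem_sdiff.2 ⟨ha, haB⟩
        obtain ⟨p, q', hpq, hpair⟩ := Finset.card_eq_two.1 hcard
        rw [hpair, Finset.mem_insert, Finset.mem_singleton] at ha' hxS hzS
        rcases ha' with rfl | rfl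
        · rcases hxS with rfl | rfl
          · exact Or.inl rfl
          · rcases hzS with rfl | rfl
            · exact Or.inr (Or.inl rfl)
            · exact absurd rfl hxz
        · rcases hzS with rfl | rfl
          · rcases hxS with rfl | rfl
            · exact absurd rfl hxz
            · exact Or.inl rfl
          · exact Or.inr (Or.inl rfl)
    · rw [Finset.card_insert_of_notMem hxQ, Finset.card_insert_of_notMem
        (notMem_of_notMem_clF (mem_membersIn.1 (mem_thinMembers.1 hthin).1).1 (Finset.mem_sdiff.1 hzc).2)]
      have := Finset.card_sdiff_add_card_inter S B
      rw [hcard, Finset.inter_eq_right.2 hBS] at this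
      omega
  refine ⟨x, ?_, ?_⟩
  · rw [Finset.mem_sdiff]
    refine ⟨(Finset.mem_sdiff.1 hxS).1, fun hxK => ?_⟩
    have hKB : coloops M G ⊆ B := coloops_subset_of_mem_thinMembers hG hd' hthin
    exact hxB (hKB hxK)
  · rw [hSeq, Finset.erase_insert hxQ]
    exact hbad

open scoped Classical in
/-- **The fair-share capacity at a target that is not weakly bad is at least `11/60`**: it is not bad, and it
receives no distance-one load. -/
theorem cap3_ge_of_not_wbad (hG : G ∈ flatsQ M (5 + 1)) (hd : (gr M \ G).card = 3) (hk : kColoops M G = 2)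
    {P : Finset α → Prop} [DecidablePred P] {S : Finset α} (hS : S ∈ shadowAt M (5 + 2) 5 (Uq M (5 + 2) 5) G)
    (hnw : ¬ WBadTarget M G S) (h5 : 4 + 1 ≤ (S \ coloops M G).card) :
    11 / 60 ≤ cap3 M 5 G P (dshMissed M 5 G) S := by
  have hnb : ¬ BadTarget M G S := by
    intro hb
    apply hnw
    obtain ⟨w, hw, w', hw', hne, hr⟩ := hb
    -- a third point `x` of `S ∖ K` outside `{w, w′}` exists (`|S ∖ K| ≥ 5`)
    have hex : ∃ x ∈ S \ coloops M G, x ≠ w ∧ x ≠ w' := by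
      by_contra hcon
      push Not at hcon
      have hsub : S \ coloops M G ⊆ {w, w'} := by
        intro a ha
        rw [Finset.mem_insert, Finset.mem_singleton]
        by_contra h
        push Not at h
        exact h.2 (hcon a ha h.1)
      have := Finset.card_le_card hsub
      rw [Finset.card_pair hne] at this
      omega
    obtain ⟨x, hx, hxw, hxw'⟩ := hex
    refine ⟨x, hx, w, ?_, w', ?_, hne, ?_⟩
    · rw [Finset.mem_sdiff, Finset.mem_erase]
      exact ⟨⟨Ne.symm hxw, (Finset.mem_sdiff.1 hw).1⟩, (Finset.mem_sdiff.1 hw).2⟩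
    · rw [Finset.mem_sdiff, Finset.mem_erase]
      exact ⟨⟨Ne.symm hxw', (Finset.mem_sdiff.1 hw').1⟩, (Finset.mem_sdiff.1 hw').2⟩
    · refine le_trans (rkN_mono ?_) hr
      intro a ha
      rw [Finset.mem_sdiff, Finset.mem_sdiff, Finset.mem_erase] at ha
      rw [Finset.mem_sdiff, Finset.mem_sdiff]
      exact ⟨⟨ha.1.1.2, ha.1.2⟩, ha.2⟩
  have hdl : dload M 5 G P (dshMissed M 5 G) S = 0 := by
    by_contra h
    exact hnw (wbad_of_dload_ne_zero hG hd hk h)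
  have hc2 := cap2_ge_of_not_bad hG hd hk hS hnb
  unfold cap3
  rw [hdl]
  linarith

end WeakBad

end PercRepro.Shadow
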